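import Literature.Analysis.FluidPDE.LerayHopf
import HarnessLib

/-!
# `TypeIliouvilleNoTypeII` (stmt-NavierStokesRegularity-0056), line `Sketch` (gradient-bkm-pivot) —
# STUB 3: energy bookkeeping for the crux's Leray–Hopf class

Support file (`--supports stmt-NavierStokesRegularity-0056`) for the crux
`Summit.NavierStokesRegularity.NavierStokesRegularity.Theses.TypeILiouville.TypeIliouvilleNoTypeII`
(no Type-II blow-up), line `Sketch` of pass c1 (idea `gradient-bkm-pivot`). The line's glue
`velocityThreeFifths` combines the kinematic 3/5 law with the bound `‖u(t)‖₂ ≤ ‖u(0)‖₂`; this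
file supplies the latter for the crux's class.

* `stub_energyBound`: every slice `u t`, `t ∈ [0, T]`, of a Leray–Hopf solution with zero force
  and datum `u 0` is square integrable (the field `IsLerayHopfOn.memLp`) and
  `∫ ‖u t‖² ≤ ∫ ‖u 0‖²`: the energy inequality from `s = 0`
  (`IsLerayHopfOn.energy_ineq_zero`, Leray 1934, §31 (5.2)) reads
  `½∫‖u t‖² + ν ∫₀ᵗ∫|G|² ≤ ½∫‖u 0‖² + ∫₀ᵗ∫⟪0, u⟫`; the forcing term vanishes and the
  dissipation `ν · (∫⁻ …).toReal` is nonnegative for `ν > 0`.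

## References

* J. Leray, *Sur le mouvement d'un liquide visqueux emplissant l'espace*, Acta Math. 63 (1934),
  §31, (5.2) (energy inequality of the solutions turbulentes). [Leray1934]
* G. P. Galdi, *An introduction to the Navier–Stokes initial-boundary value problem* (2000),
  Def. 2.1 (ii).
-/

noncomputable section

-- the summit and its single problem share the name (D-0017 nested layout)
set_option linter.dupNamespace false

open Set Function Filter Topology MeasureTheory Metric
open scoped NNReal ENNReal
open Literature.Analysis Literature.Analysis.FluidPDE

namespace Summit.NavierStokesRegularity.NavierStokesRegularity.Theorems

namespace TypeIliouvilleNoTypeII.GradientPivot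

/-- `ℝ³` (the notation of the line's skeleton; the registered stub headers are spelled with it). -/
local notation "E3" => EuclideanSpace ℝ (Fin 3)

/-- **STUB 3: energy bookkeeping for the crux's class.** Every slice `u t`, `t ∈ [0, T]`, of a
Leray–Hopf solution on `ℝ³ × [0, T)` with viscosity `ν > 0`, zero force and datum `u 0` is square
integrable, with `∫ ‖u t‖² ≤ ∫ ‖u 0‖²`. Square integrability is the field `IsLerayHopfOn.memLp`;
the bound is the energy inequality from `s = 0` (`IsLerayHopfOn.energy_ineq_zero`):
`½∫‖u t‖² + ν ∫₀ᵗ∫|G|² ≤ ½∫‖u 0‖² + ∫₀ᵗ∫⟪0, u⟫`, whose forcing term vanishes and whose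
dissipation term `ν · (∫⁻ …).toReal` is nonnegative. [cite: Leray1934, §31 (5.2)] -/
theorem stub_energyBound (ν T : ℝ) (hν : 0 < ν) (u : ℝ → E3 → E3)
    (hLH : IsLerayHopfOn T ν 0 (u 0) u) :
    ∀ t ∈ Icc 0 T, MemLp (u t) 2 volume ∧ ∫ x, ‖u t x‖ ^ 2 ≤ ∫ x, ‖u 0 x‖ ^ 2 := by
  obtain ⟨G, -, hE⟩ := hLH.energy_ineq_zero
  intro t ht
  refine ⟨hLH.memLp t ht, ?_⟩
  have h := hE t ht
  have hdiss :
      0 ≤ ν * (∫⁻ τ in Ioo 0 t, ∫⁻ x, ENNReal.ofReal (frobeniusNormSq (G τ x))).toReal :=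
    mul_nonneg hν.le ENNReal.toReal_nonneg
  simp only [Pi.zero_apply, inner_zero_left, integral_zero, intervalIntegral.integral_zero,
    add_zero] at h
  simp only [VectorCalculus.kineticEnergy] at h
  linarith

end TypeIliouvilleNoTypeII.GradientPivot

end Summit.NavierStokesRegularity.NavierStokesRegularity.Theorems
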